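import Literature.MeasureTheory.Group.InvariantQuotientOrbitalTransport        -- ★ `cosetCongr{,Homeomorph}`, `descConj_cosetCongr_apply`, `forall_apply_mem_centralizer_singleton_iff_of_eq`
import Literature.MeasureTheory.Group.InvariantQuotientAdaptedUnfoldingBound     -- ★ p849197 `integrable_descConj_of_measure_preimage_lt_top` (Rao finiteness ⇒ integrability)
import HarnessLib

/-!
# RANGA-RAO FINITENESS IS A PROPERTY OF THE CONJUGACY CLASS: transport of «`μ{yC(γ) ∣ y γ y⁻¹ ∈ C} < ∞` for every invariant Radon `μ` and
# every compact `C`» along an isomorphism of topological groups, in particular along an inner automorphism `γ ↦ g γ g⁻¹`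

Topic `MeasureTheory/Group`; namespace `Literature.MeasureTheory.Group`.  THEOREMS ONLY (no definition, no instance, no notation, no named fact, no `sorry`).
Cell `pub/hodgecm-mathlib`, crux H413 (`stmt-HodgeConjecture-24833`), line LH4 «Shalika germs», organ ‹RAO› (the Ranga-Rao clause of `stub_ShRao`; road (α′) of the
census memo `RAO-CONV.census.F0P3ap09g4.md` 476bb72b §2 (IV) «transport to any `γ` of the class»); LH10-p01 (g2), SECOND on «RAO-TRANSV MAIN» (LH4-plan (g2) DEALER
WORDS #24 (c)), the GENERIC half of sub-head (IV) «assembly-to-head».  Any topological groups; nothing printed is proved.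

WHY.  Road (α′) proves the Rao clause «`y C(u) ↦ f(y u y⁻¹)` is `μ`-integrable for every `f ∈ C_c^∞(G)` and every `G`-invariant measure `μ` on `G ⧸ C(u)` finite on
compacta» at ONE base point `u` of each unipotent class (a corner `n(t₀)`, resp. a regular `u(1, −t₀)`), in the μ-GENERIC form «`μ{y C(u) ∣ y u y⁻¹ ∈ C} < ∞` for every
compact `C`».  Because the statement quantifies over ALL invariant Radon `μ`, it TRANSPORTS to every conjugate `γ = g u g⁻¹` with no uniqueness-of-invariant-measure
argument and no scalar: pull `μ` on `G ⧸ C(γ)` back along the homeomorphism `G ⧸ C(u) ≃ₜ G ⧸ C(γ)`, `yC(u) ↦ (g y g⁻¹) C(γ)` (★ `cosetCongrHomeomorph` at `e = conj(g)`), which is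
again invariant and finite on compacta, and read `{yC(γ) ∣ y γ y⁻¹ ∈ C}` as the image of `{xC(u) ∣ x u x⁻¹ ∈ g⁻¹ C g}` (★ `descConj_cosetCongr_apply`).  Stated for an arbitrary
bicontinuous isomorphism `e : G ≃* G'` (so the same lemma also moves the clause across the frame `ψ : U(H)(L⁺_v) ≃ U(σ, J₀)(L_w)` if a consumer wants it there).

CONTENTS.
* §1 `preimage_descConj_id_cosetCongr` — `(cosetCongr e)⁻¹' {y ∣ y γ' y⁻¹ ∈ C'} = {x ∣ x γ x⁻¹ ∈ e⁻¹ C'}`; invariance of the transported measure is ★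
  `smulInvariantMeasure_map_cosetCongr_of_smulInvariant` (`InvariantQuotientOrbitalProd`, any invariant `μ`).
* §2 **`measure_preimage_descConj_lt_top_of_mulEquiv`** — Rao finiteness at `γ` for all invariant Radon `μ` ⇒ Rao finiteness at `γ' = e γ` for all invariant Radon `μ'`;
  **`measure_preimage_descConj_lt_top_of_conj`** (`e = conj(g)`, `γ' = g γ g⁻¹`) and **`…_of_isConj`**.
* §3 the integrability form: **`integrable_descConj_of_isConj_of_forall_measure_preimage_lt_top`** — from Rao finiteness at a base point `u`, for every `γ` conjugate to `u`,
  every invariant Radon `μ` on `G ⧸ C(γ)` and every continuous compactly supported `f`, `Integrable (descConj γ C(γ) _ f) μ` (★ p849197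
  `integrable_descConj_of_measure_preimage_lt_top`).
HONEST LABEL: HC_CM is proved only modulo the 7 printed citations (2 remaining: hLiu418 = stmt-HodgeConjecture-24832, h413 = stmt-HodgeConjecture-24833) until rung 0
closes; this file is measure-theoretic bookkeeping and pays nothing by itself.

## References
* [Rao1972] R. Ranga Rao, *Orbital integrals in reductive groups*, Ann. of Math. (2) 96 (1972) 505–510, Theorem (p. 505).
* [Rogawski1990] J. Rogawski, *Automorphic Representations of Unitary Groups in Three Variables* (1990), §4.9 p. 54, §8.1 p. 112.
* [Folland1995] G. B. Folland, *A Course in Abstract Harmonic Analysis* (1995), §2.6 (homogeneous spaces, invariant measures).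
-/

set_option autoImplicit false

noncomputable section

open MeasureTheory Measure Topology Set Filter

namespace Literature.MeasureTheory.Group

/-! ## §1 Invariance of the transported measure; the orbit-preimage under `cosetCongr` -/

section Algebra

variable {G G' : Type*} [Group G] [Group G'] (e : G ≃* G') {γ : G} {γ' : G'} (hγ : e γ = γ')

/-- **`(cosetCongr e)⁻¹' {yC(γ') ∣ y γ' y⁻¹ ∈ C'} = {xC(γ) ∣ x γ x⁻¹ ∈ e⁻¹' C'}`** (★ `descConj_cosetCongr_apply` at `F = id`). [cite: Rao1972, Theorem] -/
theorem preimage_descConj_id_cosetCongr (C' : Set G') :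
    cosetCongr e _ _ (forall_apply_mem_centralizer_singleton_iff_of_eq e hγ) ⁻¹'
        (descConj γ' (Subgroup.centralizer ({γ'} : Set G')) (fun _ hg => Subgroup.mem_centralizer_singleton_iff.1 hg) id ⁻¹' C') =
      descConj γ (Subgroup.centralizer ({γ} : Set G)) (fun _ hg => Subgroup.mem_centralizer_singleton_iff.1 hg) id ⁻¹' (e ⁻¹' C') := by
  ext x
  induction x using QuotientGroup.induction_on with
  | H y => simp only [Set.mem_preimage, cosetCongr_mk, descConj_mk, id, map_mul, map_inv, hγ]

end Algebra



/-! ## §2 Rao finiteness transports along a bicontinuous isomorphism, in particular along conjugation -/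

section Finite

variable {G G' : Type*} [Group G] [Group G'] [TopologicalSpace G] [TopologicalSpace G'] [IsTopologicalGroup G]
  (e : G ≃* G') (he : Continuous e) (hes : Continuous e.symm) {γ : G} {γ' : G'} (hγ : e γ = γ')
  [MeasurableSpace (G ⧸ Subgroup.centralizer ({γ} : Set G))] [BorelSpace (G ⧸ Subgroup.centralizer ({γ} : Set G))]
  [MeasurableSpace (G' ⧸ Subgroup.centralizer ({γ'} : Set G'))] [BorelSpace (G' ⧸ Subgroup.centralizer ({γ'} : Set G'))]

include he hes hγ in
/-- **RAO FINITENESS TRANSPORTS ALONG `e : G ≃* G'`.**  If at `γ ∈ G` EVERY `G`-invariant measure on `G ⧸ C(γ)` finite on compacta gives finite mass to `{xC(γ) ∣ x γ x⁻¹ ∈ C}`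
for every compact `C`, then at `γ' = e γ` every `G'`-invariant measure `μ'` on `G' ⧸ C(γ')` finite on compacta gives finite mass to `{yC(γ') ∣ y γ' y⁻¹ ∈ C'}` for every
compact `C'`: pull `μ'` back along the homeomorphism `cosetCongrHomeomorph e` (invariant by §1, finite on compacta — Mathlib `IsFiniteMeasureOnCompacts.map`) and use
`preimage_descConj_id_cosetCongr` with the compact `e⁻¹(C')`. [cite: Rao1972, Theorem] [cite: Folland1995, §2.6] -/
theorem measure_preimage_descConj_lt_top_of_mulEquiv
    (h : ∀ (μ : Measure (G ⧸ Subgroup.centralizer ({γ} : Set G))) [SMulInvariantMeasure G (G ⧸ Subgroup.centralizer ({γ} : Set G)) μ]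
      [IsFiniteMeasureOnCompacts μ] (C : Set G), IsCompact C →
        μ (descConj γ (Subgroup.centralizer ({γ} : Set G)) (fun _ hg => Subgroup.mem_centralizer_singleton_iff.1 hg) id ⁻¹' C) < ⊤)
    (μ' : Measure (G' ⧸ Subgroup.centralizer ({γ'} : Set G'))) [SMulInvariantMeasure G' (G' ⧸ Subgroup.centralizer ({γ'} : Set G')) μ']
    [IsFiniteMeasureOnCompacts μ'] {C' : Set G'} (hC' : IsCompact C') :
    μ' (descConj γ' (Subgroup.centralizer ({γ'} : Set G')) (fun _ hg => Subgroup.mem_centralizer_singleton_iff.1 hg) id ⁻¹' C') < ⊤ := by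
  -- the homeomorphism `ψ : G ⧸ C(γ) ≃ₜ G' ⧸ C(γ')` and the pulled-back measure `μ := ψ⁻¹_* μ'`
  set ψ := cosetCongrHomeomorph e _ _ (forall_apply_mem_centralizer_singleton_iff_of_eq e hγ) he hes with hψ
  have hψe : ⇑ψ = cosetCongr e _ _ (forall_apply_mem_centralizer_singleton_iff_of_eq e hγ) := rfl
  set μ : Measure (G ⧸ Subgroup.centralizer ({γ} : Set G)) := μ'.map ψ.symm with hμ
  haveI : IsFiniteMeasureOnCompacts μ := IsFiniteMeasureOnCompacts.map μ' ψ.symm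
  -- `μ` is `G`-invariant: `ψ⁻¹ = cosetCongr e⁻¹`
  haveI : SMulInvariantMeasure G (G ⧸ Subgroup.centralizer ({γ} : Set G)) μ := by
    have hsymm : ⇑ψ.symm = cosetCongr e.symm _ _
        (forall_symm_mem_iff e _ _ (forall_apply_mem_centralizer_singleton_iff_of_eq e hγ)) := rfl
    rw [hμ, hsymm]
    exact smulInvariantMeasure_map_cosetCongr_of_smulInvariant e.symm hes _ _ _ μ'
  -- `μ' = ψ_* μ` and the orbit-preimage is the `ψ`-preimage of the transported one
  have hμ' : μ' = μ.map ψ := by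
    rw [hμ, Measure.map_map ψ.continuous.measurable ψ.symm.continuous.measurable]
    have hid : (⇑ψ ∘ ⇑ψ.symm) = id := funext fun y => ψ.apply_symm_apply y
    rw [hid, Measure.map_id]
  have hpre : ψ ⁻¹' (descConj γ' (Subgroup.centralizer ({γ'} : Set G')) (fun _ hg => Subgroup.mem_centralizer_singleton_iff.1 hg) id ⁻¹' C') =
      descConj γ (Subgroup.centralizer ({γ} : Set G)) (fun _ hg => Subgroup.mem_centralizer_singleton_iff.1 hg) id ⁻¹' (e ⁻¹' C') := by
    rw [hψe]
    exact preimage_descConj_id_cosetCongr e hγ C'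
  rw [hμ', ← Homeomorph.toMeasurableEquiv_coe, MeasurableEquiv.map_apply, Homeomorph.toMeasurableEquiv_coe, hpre]
  -- `e⁻¹(C')` is compact
  have hC : IsCompact (e ⁻¹' C') := by
    have heq : e ⁻¹' C' = e.symm '' C' := by
      ext x
      constructor
      · intro hx
        exact ⟨e x, hx, e.symm_apply_apply x⟩
      · rintro ⟨y, hy, rfl⟩
        show e (e.symm y) ∈ C'
        rwa [e.apply_symm_apply]
    rw [heq]
    exact hC'.image hes
  exact h μ (e ⁻¹' C') hC

end Finite

section Conj

variable {G : Type*} [Group G] [TopologicalSpace G] [IsTopologicalGroup G] {γ : G}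
  [∀ γ : G, MeasurableSpace (G ⧸ Subgroup.centralizer ({γ} : Set G))] [∀ γ : G, BorelSpace (G ⧸ Subgroup.centralizer ({γ} : Set G))]

/-- **RAO FINITENESS IS CONJUGATION-INVARIANT**: Rao finiteness at `γ` for all invariant Radon measures ⇒ Rao finiteness at `g γ g⁻¹` for all invariant Radon measures
(`measure_preimage_descConj_lt_top_of_mulEquiv` at `e = conj(g)`). [cite: Rao1972, Theorem] [cite: Rogawski1990, §4.9 p. 54] -/
theorem measure_preimage_descConj_lt_top_of_conj
    (h : ∀ (μ : Measure (G ⧸ Subgroup.centralizer ({γ} : Set G))) [SMulInvariantMeasure G (G ⧸ Subgroup.centralizer ({γ} : Set G)) μ]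
      [IsFiniteMeasureOnCompacts μ] (C : Set G), IsCompact C →
        μ (descConj γ (Subgroup.centralizer ({γ} : Set G)) (fun _ hg => Subgroup.mem_centralizer_singleton_iff.1 hg) id ⁻¹' C) < ⊤)
    (g : G) (μ' : Measure (G ⧸ Subgroup.centralizer ({g * γ * g⁻¹} : Set G)))
    [SMulInvariantMeasure G (G ⧸ Subgroup.centralizer ({g * γ * g⁻¹} : Set G)) μ'] [IsFiniteMeasureOnCompacts μ'] {C' : Set G} (hC' : IsCompact C') :
    μ' (descConj (g * γ * g⁻¹) (Subgroup.centralizer ({g * γ * g⁻¹} : Set G)) (fun _ hg => Subgroup.mem_centralizer_singleton_iff.1 hg) id ⁻¹' C') < ⊤ :=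
  measure_preimage_descConj_lt_top_of_mulEquiv (MulAut.conj g) (IsTopologicalGroup.continuous_conj g)
    (by
      have hfun : ⇑(MulAut.conj g).symm = fun h : G => g⁻¹ * h * g := funext fun h => MulAut.conj_symm_apply g h
      rw [hfun]
      exact (continuous_const.mul continuous_id).mul continuous_const)
    (MulAut.conj_apply g γ) h μ' hC'

/-- **RAO FINITENESS ALONG `IsConj`**: the same for any `γ'` conjugate to `γ`. [cite: Rao1972, Theorem] [cite: Rogawski1990, §4.9 p. 54] -/
theorem measure_preimage_descConj_lt_top_of_isConj
    (h : ∀ (μ : Measure (G ⧸ Subgroup.centralizer ({γ} : Set G))) [SMulInvariantMeasure G (G ⧸ Subgroup.centralizer ({γ} : Set G)) μ]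
      [IsFiniteMeasureOnCompacts μ] (C : Set G), IsCompact C →
        μ (descConj γ (Subgroup.centralizer ({γ} : Set G)) (fun _ hg => Subgroup.mem_centralizer_singleton_iff.1 hg) id ⁻¹' C) < ⊤)
    {γ' : G} (hc : IsConj γ γ') (μ' : Measure (G ⧸ Subgroup.centralizer ({γ'} : Set G)))
    [SMulInvariantMeasure G (G ⧸ Subgroup.centralizer ({γ'} : Set G)) μ'] [IsFiniteMeasureOnCompacts μ'] {C' : Set G} (hC' : IsCompact C') :
    μ' (descConj γ' (Subgroup.centralizer ({γ'} : Set G)) (fun _ hg => Subgroup.mem_centralizer_singleton_iff.1 hg) id ⁻¹' C') < ⊤ := by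
  obtain ⟨c, hcγ⟩ := isConj_iff.1 hc
  subst hcγ
  exact measure_preimage_descConj_lt_top_of_conj h c μ' hC'

/-! ## §3 The integrability form (the Ranga-Rao clause as consumed) -/

variable [MeasurableSpace G] [BorelSpace G]

/-- **THE RAO CLAUSE ALONG A CONJUGACY CLASS**: if at the base point `γ` every invariant Radon measure gives finite mass to the orbit-preimages of compacta, then for every
`γ'` conjugate to `γ`, every `G`-invariant measure `μ'` on `G ⧸ C(γ')` finite on compacta and every continuous compactly supported `f : G → E`, the orbital integrand
`y C(γ') ↦ f(y γ' y⁻¹)` is `μ'`-integrable (§2 + ★ p849197 `integrable_descConj_of_measure_preimage_lt_top`). [cite: Rao1972, Theorem] [cite: Rogawski1990, §4.9 p. 54; §8.1 p. 112] -/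
theorem integrable_descConj_of_isConj_of_forall_measure_preimage_lt_top
    (h : ∀ (μ : Measure (G ⧸ Subgroup.centralizer ({γ} : Set G))) [SMulInvariantMeasure G (G ⧸ Subgroup.centralizer ({γ} : Set G)) μ]
      [IsFiniteMeasureOnCompacts μ] (C : Set G), IsCompact C →
        μ (descConj γ (Subgroup.centralizer ({γ} : Set G)) (fun _ hg => Subgroup.mem_centralizer_singleton_iff.1 hg) id ⁻¹' C) < ⊤)
    {γ' : G} (hc : IsConj γ γ') (μ' : Measure (G ⧸ Subgroup.centralizer ({γ'} : Set G)))
    [SMulInvariantMeasure G (G ⧸ Subgroup.centralizer ({γ'} : Set G)) μ'] [IsFiniteMeasureOnCompacts μ']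
    {E : Type*} [NormedAddCommGroup E] {f : G → E} (hfc : Continuous f) (hf : HasCompactSupport f) :
    Integrable (descConj γ' (Subgroup.centralizer ({γ'} : Set G)) (fun _ hg => Subgroup.mem_centralizer_singleton_iff.1 hg) f) μ' :=
  integrable_descConj_of_measure_preimage_lt_top γ' _ _ μ' (fun _ hC => measure_preimage_descConj_lt_top_of_isConj h hc μ' hC) hfc hf

end Conj

end Literature.MeasureTheory.Group

end
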